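import Literature.NumberTheory.Weil1964.RealChirpIntegralDecay
import Literature.NumberTheory.Weil1965.FinAdelicQuadraticGaussTransformDecay
import Literature.NumberTheory.Weil1964.AdelicChirpIntegralDilation
import Literature.NumberTheory.Automorphic.AdelicHeightAffineLineAdele
import Literature.NumberTheory.QuadraticForms.HasseMinkowskiDiagonal
import Literature.NumberTheory.Automorphic.AdicCompletionResidueCard
import HarnessLib

/-!
# The adelic Gauss-transform majorant `‖∫ ψ_F(η·q_S(x)) Φ(x) dν‖ ≤ A(Φ) · h(1, η)^{−m/2}` (Weil's condition (B))

Topic `NumberTheory/Weil1965`; namespace `Literature.NumberTheory.Weil1965`.  KERNEL mathematics only (theorems; no definition,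
no named fact, no `axiom`, no `sorry`).  Assembly of ★ `Weil1964/RealChirpIntegralDecay` (archimedean blocks) and ★
`Weil1965/FinAdelicQuadraticGaussTransformDecay` (finite places).

For a TOTALLY REAL number field `F`, a symmetric matrix `S ∈ Sym_m(F)` with `det S ≠ 0`, a Schwartz–Bruhat function
`Φ ∈ 𝒮(𝔸_F^m)` (★ `piSchwartzBruhat`) and a Haar measure `ν` on `𝔸_F^m`, the GAUSS TRANSFORM `η ↦ ∫ ψ_F(η · x S xᵀ) Φ(x) dν(x)`
(`= ∫ chirp F (η • ratMatrix S) Φ ∂ν`, Weil's `F*_Φ`) satisfies, for EVERY ADELE `η ∈ 𝔸_F`,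

  `‖∫ chirp F (η • ratMatrix S) Φ ∂ν‖ ≤ A · h(1, η)^{−m/2}`   (`exists_norm_integral_chirp_smul_ratMatrix_le_vecHeight`),

`h = vecHeight` the Godement–Garrett height of the adelic vector `(1, η)` (★ `AdelicVectorHeight`), with `A = A(Φ, S, ν)`
independent of `η` — [Weil1965, Chap. I n° 2 Prop. 2 (local decay); Chap. IV n° 40 Thm. 1 (p. 57), n° 41 (the majorant
`Π_v sup(1, |η_v|)^{−m/2}` of condition (B))].  Also in the split form `A · (Π_{w∣∞} max(1,|η_w|))^{−m/2} · (Π_{v∤∞} max(1,|η_v|_v))^{−m/2}`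
(`exists_norm_integral_chirp_smul_ratMatrix_le`).

Road: (§1) diagonalise `S = Qᵀ diag(d) Q` over `F` (★ `QuadraticForms.exists_congr_diagonal`) and move `Q` onto `Φ` by the
dilation law ★ `integral_chirp_conj_twist` (`𝒮` is stable, ★ `twist_mem`); (§2) for a pure tensor `Φ_∞ ⊗ Φ_f` the character and the
Haar measure split along `𝔸_F^m = (F ⊗ ℝ)^m × (𝔸_F^∞)^m` (★ `sdChar_eq_mul`, ★ `exists_haar_eq_smul_map_prod`), giving the product of
the ARCHIMEDEAN factor — real coordinates `(F ⊗ ℝ)^m ≅ ℝ^{m·r₁}`, diagonal chirp with block parameters `η_w`, ★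
`exists_norm_integral_realChirpPi_blocks_le` — and the FINITE factor ★ `exists_norm_integral_mul_finiteAdeleAddChar_sum_sq_le`;
(§3) pure tensors span `𝒮(𝔸_F^m)`; (§4) `Π_w max(1,|η_w|) · Π_v max(1,|η_v|_v) ≥ 2^{−r₁/2} h(1,η)` (★ `AdelicHeightAffineLineAdele`).

Cell `hodgecm-mathlib`, FLOOR 0, crux H413 (stmt-HodgeConjecture-24833), E-2 ∕ SW2c-BOUND sheet §2, letter (E1) = (HM) (M4).  HC_CM is
proved only modulo the 7 printed citations until rung 0 closes; this file is unconditional.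

## References
* [Weil1965] A. Weil, *Sur la formule de Siegel dans la théorie des groupes classiques*, Acta Math. 113 (1965): Chap. I n° 2
  Prop. 2 (p. 8); Chap. IV n° 40 Thm. 1 (p. 57), n° 41 (pp. 58–59).
* [Weil1964] A. Weil, *Sur certains groupes d'opérateurs unitaires*, Acta Math. 111 (1964): Chap. I n° 14 Thm 2 (p. 161);
  Chap. II n° 25 (p. 173).
* [Garrett2018] P. Garrett, *Modern Analysis of Automorphic Forms by Example* (2018), §2.2 (heights).
-/

set_option autoImplicit false

noncomputable section

open MeasureTheory Filter Topology Set NumberField NumberField.InfinitePlace NumberField.mixedEmbedding IsDedekindDomain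
open scoped NNReal ENNReal Matrix Real FourierTransform SchwartzMap Classical
open Literature.NumberTheory.Automorphic
open Literature.NumberTheory.Weil1964
open Literature.NumberTheory.GaloisRepresentations.IsNonarchimedeanLocalField (normAbs)

namespace Literature.NumberTheory.Weil1965

/-! ## §1 The archimedean factor of a totally real field: transport to `ℝ^{m·r₁}` and the block bound -/

section Arch

variable (F : Type) [Field F] [NumberField F] [IsTotallyReal F] (m : ℕ)

omit [NumberField F] in
/-- a totally real field has no complex place. [folklore] -/
private theorem isEmpty_isComplex : IsEmpty {w : InfinitePlace F // w.IsComplex} :=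
  ⟨fun w => (not_isReal_iff_isComplex.2 w.2) (IsTotallyReal.isReal w.1)⟩

/-- **THE ARCHIMEDEAN GAUSS-TRANSFORM BOUND FOR A TOTALLY REAL FIELD**: for non-zero `dᵢ ∈ F`, a Haar measure `μ_∞` on
`(F ⊗ ℝ)^m` and a Schwartz `Φ_∞` there is `C ≥ 0` with, for EVERY `s ∈ F ⊗ ℝ`,
`‖∫ 𝐞(−Σᵢ Tr(s dᵢ aᵢ²)) Φ_∞(a) dμ_∞‖ ≤ C · ∏_{w ∣ ∞} max(1, |s_w|)^{−m/2}` — transport to the Euclidean space `ℝ^{m × r₁}` (real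
coordinates `a ↦ (a_{i,w})`), where the phase is the diagonal chirp `∏ e^{2πi (−s_w σ_w(dᵢ)) a_{i,w}²}` and ★
`exists_norm_integral_realChirpPi_blocks_le` applies with blocks = places. [cite: Weil1965, Chap. I n° 2 Prop. 2, p. 8] -/
theorem exists_norm_integral_archSdChar_diagonal_mul_le (μE : Measure (Fin m → mixedSpace F)) [μE.IsAddHaarMeasure]
    {d : Fin m → F} (hd : ∀ i, d i ≠ 0) (Φinf : 𝓢((Fin m → mixedSpace F), ℂ)) :
    ∃ C : ℝ, 0 ≤ C ∧ ∀ s : mixedSpace F,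
      ‖∫ a, archSdChar F (Matrix.diagonal fun i => s * mixedEmbedding F (d i)) a * Φinf a ∂μE‖ ≤
        C * ∏ w : {w : InfinitePlace F // w.IsReal}, (max 1 |s.1 w|) ^ (-((m : ℝ) / 2)) := by
  classical
  haveI : IsEmpty {w : InfinitePlace F // w.IsComplex} := isEmpty_isComplex F
  -- real coordinates `a ↦ (a_{i,w})_{(i,w)}`
  set W := {w : InfinitePlace F // w.IsReal} with hW
  set e₀ : (Fin m → mixedSpace F) ≃ₗ[ℝ] EuclideanSpace ℝ (Fin m × W) :=
    { toFun := fun a => WithLp.toLp 2 fun j => (a j.1).1 j.2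
      invFun := fun y i => (fun w => y (i, w), fun w => isEmptyElim w)
      map_add' := fun a b => by ext j; rfl
      map_smul' := fun r a => by ext j; rfl
      left_inv := fun a => by
        funext i
        exact Prod.ext (funext fun w => rfl) (funext fun w => isEmptyElim w)
      right_inv := fun y => by ext j; rfl } with he₀
  set L : (Fin m → mixedSpace F) ≃L[ℝ] EuclideanSpace ℝ (Fin m × W) := e₀.toContinuousLinearEquiv with hL
  have hL_apply : ∀ (a : Fin m → mixedSpace F) (j : Fin m × W), L a j = (a j.1).1 j.2 := fun a j => rfl
  -- the transported Schwartz function and the weights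
  set Ψ : 𝓢(EuclideanSpace ℝ (Fin m × W), ℂ) := SchwartzMap.compCLMOfContinuousLinearEquiv ℂ L.symm Φinf with hΨ
  have hΨ_apply : ∀ y, Ψ y = Φinf (L.symm y) := fun y => rfl
  set α : Fin m × W → ℝ := fun j => -((mixedEmbedding F (d j.1)).1 j.2) with hα
  have hαne : ∀ j, α j ≠ 0 := fun j => by
    rw [hα, neg_ne_zero, mixedEmbedding_apply_isReal, ne_eq, map_eq_zero]
    exact hd j.1
  obtain ⟨C₀, hC₀0, hA⟩ := exists_norm_integral_realChirpPi_blocks_le (ι := Fin m × W) (W := W) Prod.snd hαne Ψ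
  -- Haar transport
  haveI : (μE.map L).IsAddHaarMeasure := L.isAddHaarMeasure_map μE
  set c : ℝ≥0 := (μE.map L).addHaarScalarFactor (volume : Measure (EuclideanSpace ℝ (Fin m × W))) with hc
  have hμ : μE.map L = c • (volume : Measure (EuclideanSpace ℝ (Fin m × W))) := Measure.isAddLeftInvariant_eq_smul _ _
  -- fibres of `Prod.snd` have `m` elements
  have hfib : ∀ w : W, (Finset.univ.filter fun j : Fin m × W => j.2 = w).card = m := fun w => by
    rw [show (Finset.univ.filter fun j : Fin m × W => j.2 = w) = Finset.univ.map ⟨fun i : Fin m => (i, w),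
        fun i i' h => (Prod.mk.inj h).1⟩ by
      ext j
      simp only [Finset.mem_filter, Finset.mem_univ, true_and, Finset.mem_map, Function.Embedding.coeFn_mk]
      constructor
      · rintro rfl
        exact ⟨j.1, rfl⟩
      · rintro ⟨i, rfl⟩
        rfl]
    rw [Finset.card_map, Finset.card_univ, Fintype.card_fin]
  refine ⟨(c : ℝ) * C₀, mul_nonneg (NNReal.coe_nonneg c) hC₀0, fun s => ?_⟩
  -- the phase in real coordinates
  set t : W → ℝ := fun w => s.1 w with ht
  have hphase : ∀ a : Fin m → mixedSpace F,
      archSdChar F (Matrix.diagonal fun i => s * mixedEmbedding F (d i)) a =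
        realChirpPi (fun j => t (Prod.snd j) * α j) (L a) := by
    intro a
    have hP : piTracePairing F (Fin m) a (a ᵥ* Matrix.diagonal fun i => s * mixedEmbedding F (d i)) =
        ∑ j : Fin m × W, s.1 j.2 * (mixedEmbedding F (d j.1)).1 j.2 * ((a j.1).1 j.2) ^ 2 := by
      rw [piTracePairing_apply, Fintype.sum_prod_type]
      refine Finset.sum_congr rfl fun i _ => ?_
      rw [Matrix.vecMul_diagonal, mixedTrace_apply,
        Finset.sum_eq_zero (s := (Finset.univ : Finset {w : InfinitePlace F // w.IsComplex})) (fun w _ => isEmptyElim w),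
        add_zero]
      refine Finset.sum_congr rfl fun w _ => ?_
      simp only [Prod.fst_mul, Pi.mul_apply]
      ring
    have hneg : -(piTracePairing F (Fin m) a (a ᵥ* Matrix.diagonal fun i => s * mixedEmbedding F (d i))) =
        ∑ j : Fin m × W, t j.2 * α j * (L a j) ^ 2 := by
      rw [hP, ← Finset.sum_neg_distrib]
      refine Finset.sum_congr rfl fun j _ => ?_
      rw [hL_apply]
      simp only [ht, hα]
      ring
    rw [archSdChar_apply, Real.fourierChar_apply, realChirpPi_eq_cexp_sum,
      show 2 * π * -(piTracePairing F (Fin m) a (a ᵥ* Matrix.diagonal fun i => s * mixedEmbedding F (d i))) =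
        2 * π * ∑ j : Fin m × W, t j.2 * α j * (L a j) ^ 2 by rw [hneg]]
    congr 1
    push_cast
    ring
  -- change of variables
  set G : EuclideanSpace ℝ (Fin m × W) → ℂ := fun y => realChirpPi (fun j => t (Prod.snd j) * α j) y * Ψ y with hG
  have hint : ∫ a, archSdChar F (Matrix.diagonal fun i => s * mixedEmbedding F (d i)) a * Φinf a ∂μE =
      (c : ℝ) • ∫ y : EuclideanSpace ℝ (Fin m × W), G y := by
    have h1 : (fun a => archSdChar F (Matrix.diagonal fun i => s * mixedEmbedding F (d i)) a * Φinf a) =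
        fun a => G (L.toHomeomorph.toMeasurableEquiv a) := by
      funext a
      simp only [hG, Homeomorph.toMeasurableEquiv_coe, ContinuousLinearEquiv.coe_toHomeomorph, hphase, hΨ_apply,
        ContinuousLinearEquiv.symm_apply_apply]
    have hmap : μE.map (⇑L.toHomeomorph.toMeasurableEquiv) = μE.map L := by
      rw [Homeomorph.toMeasurableEquiv_coe]
      rfl
    rw [h1, ← integral_map_equiv, hmap, hμ, integral_smul_nnreal_measure, NNReal.smul_def]
  rw [hint, _root_.norm_smul, Real.norm_eq_abs, NNReal.abs_eq, mul_assoc]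
  refine mul_le_mul_of_nonneg_left ((hA t).trans (le_of_eq ?_)) (NNReal.coe_nonneg c)
  congr 1
  refine Finset.prod_congr rfl fun w _ => ?_
  rw [hfib w]

end Arch

/-! ## §2 The coordinate matrices of `η • diag(d)` -/

section Coordinates

variable (F : Type) [Field F] [NumberField F] {m : ℕ}

/-- `η · diag(d) = diag(η dᵢ)` as adelic matrices. [folklore] -/
private theorem smul_ratMatrix_diagonal (η : AdeleRing (𝓞 F) F) (d : Fin m → F) :
    η • ratMatrix F (Matrix.diagonal d) = Matrix.diagonal fun i => η * algebraMap F (AdeleRing (𝓞 F) F) (d i) := by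
  rw [show ratMatrix F (Matrix.diagonal d) = Matrix.diagonal fun i => algebraMap F (AdeleRing (𝓞 F) F) (d i) from
    Matrix.diagonal_map (map_zero _), ← Matrix.diagonal_smul]
  rfl

/-- archimedean part of `η · diag(d)`: `diag(η_∞ · σ(dᵢ))` in `F ⊗ ℝ`. [folklore] -/
private theorem map_archHom_smul_ratMatrix_diagonal (η : AdeleRing (𝓞 F) F) (d : Fin m → F) :
    (η • ratMatrix F (Matrix.diagonal d)).map (archHom F) = Matrix.diagonal fun i => archHom F η * mixedEmbedding F (d i) := by
  rw [smul_ratMatrix_diagonal, Matrix.diagonal_map (map_zero _)]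
  congr 1
  funext i
  rw [map_mul, archHom_apply (algebraMap F (AdeleRing (𝓞 F) F) (d i)),
    InfiniteAdeleRing.mixedEmbedding_eq_algebraMap_comp]
  rfl

/-- finite part of `η · diag(d)`: `diag(η_f · dᵢ)` in `𝔸_F^∞`. [folklore] -/
private theorem map_snd_smul_ratMatrix_diagonal (η : AdeleRing (𝓞 F) F) (d : Fin m → F) :
    (η • ratMatrix F (Matrix.diagonal d)).map (RingHom.snd (InfiniteAdeleRing F) (FiniteAdeleRing (𝓞 F) F)) =
      Matrix.diagonal fun i => η.2 * algebraMap F (FiniteAdeleRing (𝓞 F) F) (d i) := by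
  rw [smul_ratMatrix_diagonal]
  refine Matrix.ext fun i j => ?_
  rw [Matrix.map_apply, Matrix.diagonal_apply, Matrix.diagonal_apply]
  split_ifs with h
  · rfl
  · exact map_zero (RingHom.snd (InfiniteAdeleRing F) (FiniteAdeleRing (𝓞 F) F))

/-- the finite second-degree character of a diagonal matrix: `ψ_f((b diag(c))·b) = ψ_f(η_f Σ dᵢ bᵢ²)` for `cᵢ = η_f dᵢ`. [folklore] -/
private theorem finSdChar_diagonal_mul (ηf : FiniteAdeleRing (𝓞 F) F) (d : Fin m → F) (b : Fin m → FiniteAdeleRing (𝓞 F) F) :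
    finSdChar (Matrix.diagonal fun i => ηf * algebraMap F (FiniteAdeleRing (𝓞 F) F) (d i)) b =
      (finiteAdeleAddChar F (ηf * ∑ i, algebraMap F (FiniteAdeleRing (𝓞 F) F) (d i) * b i ^ 2) : ℂ) := by
  have h : (b ᵥ* Matrix.diagonal fun i => ηf * algebraMap F (FiniteAdeleRing (𝓞 F) F) (d i)) ⬝ᵥ b =
      ηf * ∑ i, algebraMap F (FiniteAdeleRing (𝓞 F) F) (d i) * b i ^ 2 := by
    simp only [dotProduct, Matrix.vecMul_diagonal, Finset.mul_sum]
    exact Finset.sum_congr rfl fun i _ => by ring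
  rw [finSdChar_apply, h]

end Coordinates

/-! ## §3 The bound for a pure tensor `Φ_∞ ⊗ Φ_f` and the diagonal form -/

section Diagonal

variable (F : Type) [Field F] [NumberField F] [IsTotallyReal F] {m : ℕ}
  [MeasurableSpace (AdeleRing (𝓞 F) F)] [BorelSpace (AdeleRing (𝓞 F) F)]

omit [IsTotallyReal F] [MeasurableSpace (AdeleRing (𝓞 F) F)] [BorelSpace (AdeleRing (𝓞 F) F)] in
/-- the real coordinate of `η_∞` at a real place has absolute value `‖η_w‖`. [folklore] -/
private theorem abs_archHom_fst (η : AdeleRing (𝓞 F) F) (w : {w : InfinitePlace F // w.IsReal}) :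
    |(archHom F η).1 w| = ‖η.1 w.1‖ := by
  rw [archHom_apply, InfiniteAdeleRing.ringEquiv_mixedSpace_apply]
  dsimp only
  rw [← Real.norm_eq_abs, (AddMonoidHomClass.isometry_iff_norm _).1
    (NumberField.InfinitePlace.Completion.isometry_extensionEmbeddingOfIsReal w.2)]

/-- **PURE TENSOR, DIAGONAL FORM**: for `Φ = Φ_∞ ⊗ Φ_f` and `S = diag(d)`, `dᵢ ∈ F^×`, there is `C ≥ 0` with, for EVERY adele `η`,
`‖∫ chirp(η • diag d) Φ dν‖ ≤ C · Π_{w∣∞} max(1,‖η_w‖)^{−m/2} · (Π_{v∤∞} max(1,|η_v|_v))^{−m/2}` — the character and the Haar measure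
split (★ `sdChar_eq_mul`, ★ `exists_haar_eq_smul_map_prod`), then §1 and ★ `exists_norm_integral_mul_finiteAdeleAddChar_sum_sq_le`.
[cite: Weil1965, Chap. I n° 2 Prop. 2, p. 8; Chap. IV n° 41, pp. 58–59] -/
theorem exists_norm_integral_chirp_smul_diagonal_tensor_le (ν : Measure (Fin m → AdeleRing (𝓞 F) F)) [ν.IsAddHaarMeasure]
    {d : Fin m → F} (hd : ∀ i, d i ≠ 0) (Φinf : 𝓢((Fin m → mixedSpace F), ℂ))
    {Φfin : (Fin m → FiniteAdeleRing (𝓞 F) F) → ℂ} (hfin : Φfin ∈ SchwartzBruhat (Fin m → FiniteAdeleRing (𝓞 F) F)) :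
    ∃ C : ℝ, 0 ≤ C ∧ ∀ η : AdeleRing (𝓞 F) F,
      ‖∫ x, chirp F (η • ratMatrix F (Matrix.diagonal d))
          (fun v => Φinf (piArch F (Fin m) v) * Φfin (piFinite F (Fin m) v)) x ∂ν‖ ≤
        C * ((∏ w : {w : InfinitePlace F // w.IsReal}, (max 1 ‖η.1 w.1‖) ^ (-((m : ℝ) / 2))) *
          (((∏ᶠ v, max 1 (normAbs (v.adicCompletion F) (η.2 v)) : ℝ≥0) : ℝ) ^ (-((m : ℝ) / 2)))) := by
  -- measurable structures and Haar measures on the two factors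
  letI : MeasurableSpace (FiniteAdeleRing (𝓞 F) F) := borel _
  haveI : BorelSpace (FiniteAdeleRing (𝓞 F) F) := ⟨rfl⟩
  letI : ∀ v : HeightOneSpectrum (𝓞 F), MeasurableSpace (v.adicCompletion F) := fun v => borel _
  haveI : ∀ v : HeightOneSpectrum (𝓞 F), BorelSpace (v.adicCompletion F) := fun v => ⟨rfl⟩
  haveI : SecondCountableTopology (FiniteAdeleRing (𝓞 F) F) := secondCountableTopology_finiteAdeleRing F
  haveI : LocallyCompactSpace (FiniteAdeleRing (𝓞 F) F) := locallyCompactSpace_finiteAdeleRing' (K := F)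
  haveI : BorelSpace (Fin m → FiniteAdeleRing (𝓞 F) F) := Pi.borelSpace
  haveI : BorelSpace (Fin m → mixedSpace F) := Pi.borelSpace
  set μE : Measure (Fin m → mixedSpace F) := Measure.addHaar with hμE
  set μf : Measure (Fin m → FiniteAdeleRing (𝓞 F) F) := Measure.addHaar with hμf
  obtain ⟨c, hc, hν⟩ := exists_haar_eq_smul_map_prod F (Fin m) ν μE μf
  obtain ⟨Cinf, hCinf0, hA⟩ := exists_norm_integral_archSdChar_diagonal_mul_le F m μE hd Φinf
  obtain ⟨Cfin, hCfin0, hB⟩ := exists_norm_integral_mul_finiteAdeleAddChar_sum_sq_le F (Fin m) μf hd hfin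
  refine ⟨(c : ℝ) * Cinf * Cfin, mul_nonneg (mul_nonneg (NNReal.coe_nonneg c) hCinf0) hCfin0, fun η => ?_⟩
  -- the integrand splits
  set S : Matrix (Fin m) (Fin m) (AdeleRing (𝓞 F) F) := η • ratMatrix F (Matrix.diagonal d) with hS
  set Ginf : (Fin m → mixedSpace F) → ℂ := fun a =>
    archSdChar F (Matrix.diagonal fun i => archHom F η * mixedEmbedding F (d i)) a * Φinf a with hGinf
  set Gfin : (Fin m → FiniteAdeleRing (𝓞 F) F) → ℂ := fun b =>
    Φfin b * (finiteAdeleAddChar F (η.2 * ∑ i, algebraMap F (FiniteAdeleRing (𝓞 F) F) (d i) * b i ^ 2) : ℂ) with hGfin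
  have hsplit : ∀ p : (Fin m → mixedSpace F) × (Fin m → FiniteAdeleRing (𝓞 F) F),
      chirp F S (fun v => Φinf (piArch F (Fin m) v) * Φfin (piFinite F (Fin m) v)) (piAdeleSplit F (Fin m) p) =
        Ginf p.1 * Gfin p.2 := by
    intro p
    rw [chirp_apply, sdChar_eq_mul, piArch_piAdeleSplit, piFinite_piAdeleSplit, hS, map_archHom_smul_ratMatrix_diagonal,
      map_snd_smul_ratMatrix_diagonal, finSdChar_diagonal_mul]
    simp only [hGinf, hGfin]
    ring
  have hint : ∫ x, chirp F S (fun v => Φinf (piArch F (Fin m) v) * Φfin (piFinite F (Fin m) v)) x ∂ν =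
      (c : ℝ) • ((∫ a, Ginf a ∂μE) * ∫ b, Gfin b ∂μf) := by
    rw [integral_eq_smul_integral_prod hν]
    simp_rw [hsplit]
    rw [integral_prod_mul (μ := μE) (ν := μf) Ginf Gfin]
  rw [hint, _root_.norm_smul, Real.norm_eq_abs, NNReal.abs_eq, norm_mul]
  have h1 := hA (archHom F η)
  simp_rw [abs_archHom_fst] at h1
  have h2 : ‖∫ b, Gfin b ∂μf‖ ≤ Cfin *
      (((∏ᶠ v, max 1 (normAbs (v.adicCompletion F) (η.2 v)) : ℝ≥0) : ℝ) ^ (-((m : ℝ) / 2))) := by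
    have h := hB η.2
    rwa [Fintype.card_fin] at h
  have hP0 : 0 ≤ ∏ w : {w : InfinitePlace F // w.IsReal}, (max 1 ‖η.1 w.1‖) ^ (-((m : ℝ) / 2)) :=
    Finset.prod_nonneg fun w _ => Real.rpow_nonneg (le_trans zero_le_one (le_max_left _ _)) _
  calc (c : ℝ) * (‖∫ a, Ginf a ∂μE‖ * ‖∫ b, Gfin b ∂μf‖)
      ≤ (c : ℝ) * ((Cinf * ∏ w : {w : InfinitePlace F // w.IsReal}, (max 1 ‖η.1 w.1‖) ^ (-((m : ℝ) / 2))) *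
          (Cfin * (((∏ᶠ v, max 1 (normAbs (v.adicCompletion F) (η.2 v)) : ℝ≥0) : ℝ) ^ (-((m : ℝ) / 2))))) := by
        refine mul_le_mul_of_nonneg_left (mul_le_mul h1 h2 (norm_nonneg _) (mul_nonneg hCinf0 hP0)) (NNReal.coe_nonneg c)
    _ = (c : ℝ) * Cinf * Cfin * ((∏ w : {w : InfinitePlace F // w.IsReal}, (max 1 ‖η.1 w.1‖) ^ (-((m : ℝ) / 2))) *
          (((∏ᶠ v, max 1 (normAbs (v.adicCompletion F) (η.2 v)) : ℝ≥0) : ℝ) ^ (-((m : ℝ) / 2)))) := by ring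

/-- **DIAGONAL FORM, EVERY `Φ ∈ 𝒮(𝔸_F^m)`** (pure tensors span `𝒮`, span induction with ★ `chirp_add`∕`chirp_smul`∕`chirp_mem`).
[cite: Weil1965, Chap. I n° 2 Prop. 2, p. 8; Chap. IV n° 41, pp. 58–59] -/
theorem exists_norm_integral_chirp_smul_diagonal_le (ν : Measure (Fin m → AdeleRing (𝓞 F) F)) [ν.IsAddHaarMeasure]
    {d : Fin m → F} (hd : ∀ i, d i ≠ 0) {Φ : (Fin m → AdeleRing (𝓞 F) F) → ℂ} (hΦ : Φ ∈ piSchwartzBruhat F (Fin m)) :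
    ∃ C : ℝ, 0 ≤ C ∧ ∀ η : AdeleRing (𝓞 F) F,
      ‖∫ x, chirp F (η • ratMatrix F (Matrix.diagonal d)) Φ x ∂ν‖ ≤
        C * ((∏ w : {w : InfinitePlace F // w.IsReal}, (max 1 ‖η.1 w.1‖) ^ (-((m : ℝ) / 2))) *
          (((∏ᶠ v, max 1 (normAbs (v.adicCompletion F) (η.2 v)) : ℝ≥0) : ℝ) ^ (-((m : ℝ) / 2)))) := by
  induction hΦ using Submodule.span_induction with
  | mem Ψ hΨ =>
    obtain ⟨Φinf, Φfin, hfin, rfl⟩ := hΨ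
    exact exists_norm_integral_chirp_smul_diagonal_tensor_le F ν hd Φinf hfin
  | zero =>
    refine ⟨0, le_rfl, fun η => ?_⟩
    simp only [chirp_zero, Pi.zero_apply, integral_zero, norm_zero, zero_mul, le_refl]
  | add Ψ₁ Ψ₂ hΨ₁ hΨ₂ h₁ h₂ =>
    obtain ⟨C₁, hC₁0, hC₁⟩ := h₁
    obtain ⟨C₂, hC₂0, hC₂⟩ := h₂
    refine ⟨C₁ + C₂, add_nonneg hC₁0 hC₂0, fun η => ?_⟩
    have hi₁ : Integrable (chirp F (η • ratMatrix F (Matrix.diagonal d)) Ψ₁) ν :=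
      integrable_of_mem_piSchwartzBruhat (chirp_mem hΨ₁ _)
    have hi₂ : Integrable (chirp F (η • ratMatrix F (Matrix.diagonal d)) Ψ₂) ν :=
      integrable_of_mem_piSchwartzBruhat (chirp_mem hΨ₂ _)
    rw [chirp_add]
    simp only [Pi.add_apply]
    rw [integral_add hi₁ hi₂, add_mul]
    exact (norm_add_le _ _).trans (add_le_add (hC₁ η) (hC₂ η))
  | smul a Ψ hΨ h =>
    obtain ⟨C, hC0, hC⟩ := h
    refine ⟨‖a‖ * C, mul_nonneg (norm_nonneg _) hC0, fun η => ?_⟩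
    rw [chirp_smul]
    simp only [Pi.smul_apply, smul_eq_mul]
    rw [integral_const_mul, norm_mul, mul_assoc]
    exact mul_le_mul_of_nonneg_left (hC η) (norm_nonneg _)

end Diagonal

/-! ## §4 A general symmetric `S`: diagonalise over `F` and move the rational frame onto `Φ` -/

section General

variable (F : Type) [Field F] [NumberField F] [IsTotallyReal F] {m : ℕ}
  [MeasurableSpace (AdeleRing (𝓞 F) F)] [BorelSpace (AdeleRing (𝓞 F) F)]

omit [IsTotallyReal F] [MeasurableSpace (AdeleRing (𝓞 F) F)] [BorelSpace (AdeleRing (𝓞 F) F)] in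
/-- `ratMatrix` is multiplicative and commutes with transposition (entrywise ring homomorphism). [folklore] -/
private theorem ratMatrix_transpose_mul_diagonal_mul (Q : Matrix (Fin m) (Fin m) F) (c : Fin m → F) (η : AdeleRing (𝓞 F) F) :
    η • ratMatrix F (Qᵀ * Matrix.diagonal c * Q) =
      ratMatrix F Qᵀ * (η • ratMatrix F (Matrix.diagonal c)) * (ratMatrix F Qᵀ)ᵀ := by
  rw [show ratMatrix F (Qᵀ * Matrix.diagonal c * Q) = ratMatrix F Qᵀ * ratMatrix F (Matrix.diagonal c) * ratMatrix F Q by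
      simp only [ratMatrix, Matrix.map_mul],
    show (ratMatrix F Qᵀ)ᵀ = ratMatrix F Q by rw [ratMatrix, ratMatrix, Matrix.transpose_map, Matrix.transpose_transpose],
    Matrix.mul_smul, Matrix.smul_mul]

/-- **GENERAL SYMMETRIC FORM, split shape**: for `S ∈ Sym_m(F)` with `det S ≠ 0`, `Φ ∈ 𝒮(𝔸_F^m)` and a Haar measure `ν` there is
`C ≥ 0` with, for EVERY adele `η`,
`‖∫ chirp F (η • ratMatrix S) Φ ∂ν‖ ≤ C · Π_{w∣∞} max(1,‖η_w‖)^{−m/2} · (Π_{v∤∞} max(1,|η_v|_v))^{−m/2}`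
(`S = Qᵀ diag(c) Q` ★ `exists_congr_diagonal`; ★ `integral_chirp_conj_twist` moves `Qᵀ` onto `Φ`, ★ `twist_mem`).
[cite: Weil1965, Chap. I n° 2 Prop. 2, p. 8; Chap. IV n° 41, pp. 58–59] [cite: Weil1964, Chap. II n° 25, p. 173] -/
theorem exists_norm_integral_chirp_smul_ratMatrix_le (ν : Measure (Fin m → AdeleRing (𝓞 F) F)) [ν.IsAddHaarMeasure]
    {S : Matrix (Fin m) (Fin m) F} (hS : S.IsSymm) (hdet : S.det ≠ 0)
    {Φ : (Fin m → AdeleRing (𝓞 F) F) → ℂ} (hΦ : Φ ∈ piSchwartzBruhat F (Fin m)) :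
    ∃ C : ℝ, 0 ≤ C ∧ ∀ η : AdeleRing (𝓞 F) F,
      ‖∫ x, chirp F (η • ratMatrix F S) Φ x ∂ν‖ ≤
        C * ((∏ w : {w : InfinitePlace F // w.IsReal}, (max 1 ‖η.1 w.1‖) ^ (-((m : ℝ) / 2))) *
          (((∏ᶠ v, max 1 (normAbs (v.adicCompletion F) (η.2 v)) : ℝ≥0) : ℝ) ^ (-((m : ℝ) / 2)))) := by
  haveI : NeZero (2 : F) := ⟨two_ne_zero⟩
  obtain ⟨P, Q, c, hPQ, hQP, hdiag, hc⟩ := QuadraticForms.exists_congr_diagonal S hS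
  have hc' : ∀ i, c i ≠ 0 := hc hdet
  -- `S = Qᵀ diag(c) Q`
  have hSeq : S = Qᵀ * Matrix.diagonal c * Q := by
    rw [← hdiag]
    calc S = (P * Q)ᵀ * S * (P * Q) := by rw [hPQ, Matrix.transpose_one, Matrix.one_mul, Matrix.mul_one]
      _ = Qᵀ * (Pᵀ * S * P) * Q := by rw [Matrix.transpose_mul]; simp only [Matrix.mul_assoc]
  -- the rational frame `Qᵀ` as an adelic invertible matrix
  set γ : GL (Fin m) F := ⟨Qᵀ, Pᵀ, by rw [← Matrix.transpose_mul, hPQ, Matrix.transpose_one],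
    by rw [← Matrix.transpose_mul, hQP, Matrix.transpose_one]⟩ with hγ
  set g : GL (Fin m) (AdeleRing (𝓞 F) F) := ratGL F γ with hg
  have hgcoe : (g : Matrix (Fin m) (Fin m) (AdeleRing (𝓞 F) F)) = ratMatrix F Qᵀ := rfl
  -- the twisted test function and the diagonal bound
  obtain ⟨C, hC0, hC⟩ := exists_norm_integral_chirp_smul_diagonal_le F ν hc' (twist_mem hΦ g⁻¹)
  refine ⟨((adelicAbsDet m F g⁻¹ : ℝ≥0) : ℝ) * C, mul_nonneg (NNReal.coe_nonneg _) hC0, fun η => ?_⟩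
  have hconj : η • ratMatrix F S = (g : Matrix (Fin m) (Fin m) (AdeleRing (𝓞 F) F)) *
      (η • ratMatrix F (Matrix.diagonal c)) * (g : Matrix (Fin m) (Fin m) (AdeleRing (𝓞 F) F))ᵀ := by
    rw [hgcoe, hSeq, ratMatrix_transpose_mul_diagonal_mul]
  have htwist : Φ = twist F g (twist F g⁻¹ Φ) := by rw [← twist_mul, mul_inv_cancel, twist_one]
  rw [hconj, htwist, integral_chirp_conj_twist, _root_.norm_smul, Real.norm_eq_abs, NNReal.abs_eq, mul_assoc]
  exact mul_le_mul_of_nonneg_left (hC η) (NNReal.coe_nonneg _)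

end General

/-! ## §5 Height currency: `Π_w max(1,‖η_w‖) · Π_v max(1,|η_v|_v) ≥ 2^{−r₁/2} · h(1, η)` -/

section Height

variable (F : Type) [Field F] [NumberField F]

/-- Mathlib's norm on `F_v` is the normalised absolute value `normAbs` (both are `q_v^{-v(x)}`; ★
`GlobalHeckeTheoryGL2OfCenterInvariant.norm_eq_coe_normAbs`, reproduced to keep the import closure small). [folklore] -/
private theorem norm_eq_coe_normAbs' (v : HeightOneSpectrum (𝓞 F)) (x : v.adicCompletion F) :
    ‖x‖ = ((normAbs (v.adicCompletion F) x : ℝ≥0) : ℝ) := by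
  by_cases hx : x = 0
  · rw [hx, norm_zero, map_zero, NNReal.coe_zero]
  have hv : Valued.v x ≠ 0 := (Valuation.ne_zero_iff _).2 hx
  have hxn : Valued.v x = WithZero.exp (Multiplicative.toAdd (WithZero.unzero hv)) := by
    rw [WithZero.exp, ofAdd_toAdd, WithZero.coe_unzero]
  rw [FinitePlace.norm_def, WithZeroMulInt.toNNReal_neg_apply _ hv,
    normAbs_eq_inv_zpow_of_valued_eq v hxn, residueFieldCard_adicCompletion_eq, inv_zpow', neg_neg]
  rfl

/-- `‖x‖₊ = normAbs x` on `F_v`. [folklore] -/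
private theorem nnnorm_eq_normAbs (v : HeightOneSpectrum (𝓞 F)) (x : v.adicCompletion F) :
    ‖x‖₊ = normAbs (v.adicCompletion F) x :=
  NNReal.eq (by rw [coe_nnnorm, norm_eq_coe_normAbs'])

/-- `√(1 + x²) ≤ √2 · max(1, x)`. [folklore] -/
private theorem sqrt_one_add_sq_le (x : ℝ≥0) : NNReal.sqrt (1 + x ^ 2) ≤ NNReal.sqrt 2 * max 1 x := by
  have h : 1 + x ^ 2 ≤ 2 * (max 1 x) ^ 2 := by
    have h1 : (1 : ℝ≥0) ≤ max 1 x ^ 2 := one_le_pow₀ (le_max_left _ _)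
    have h2 : x ^ 2 ≤ max 1 x ^ 2 := pow_le_pow_left' (le_max_right _ _) 2
    calc 1 + x ^ 2 ≤ max 1 x ^ 2 + max 1 x ^ 2 := add_le_add h1 h2
      _ = 2 * max 1 x ^ 2 := by ring
  calc NNReal.sqrt (1 + x ^ 2) ≤ NNReal.sqrt (2 * max 1 x ^ 2) := NNReal.sqrt_le_sqrt.2 h
    _ = NNReal.sqrt 2 * max 1 x := by rw [NNReal.sqrt_mul, NNReal.sqrt_sq]

/-- **`h(1, η) ≤ 2^{r₁/2} · Π_{w real} max(1,‖η_w‖) · Π_v max(1,|η_v|_v)`** for a totally real `F` (★ `vecArchNorm_vecCons_one_adele`,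
★ `vecFinHeight_vecCons_one_adele`, `mult w = 1`). [cite: Garrett2018, §2.2 (PDF p. 81)] -/
theorem vecHeight_vecCons_one_le [IsTotallyReal F] (η : AdeleRing (𝓞 F) F) :
    (vecHeight F (![1, η] : Fin 2 → AdeleRing (𝓞 F) F) : ℝ) ≤
      Real.sqrt 2 ^ Fintype.card {w : InfinitePlace F // w.IsReal} *
        ((∏ w : {w : InfinitePlace F // w.IsReal}, max 1 ‖η.1 w.1‖) *
          ((∏ᶠ v, max 1 (normAbs (v.adicCompletion F) (η.2 v)) : ℝ≥0) : ℝ)) := by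
  have harch : ∀ w : InfinitePlace F, vecArchNorm F w (![1, η] : Fin 2 → AdeleRing (𝓞 F) F) ^ w.mult ≤
      NNReal.sqrt 2 * max 1 ‖η.1 w‖₊ := fun w => by
    rw [IsTotallyReal.mult_eq, pow_one, vecArchNorm_vecCons_one_adele]
    exact sqrt_one_add_sq_le (‖η.1 w‖₊)
  have hfin : (∏ᶠ v, vecFinHeight F v (![1, η] : Fin 2 → AdeleRing (𝓞 F) F)) =
      ∏ᶠ v, max 1 (normAbs (v.adicCompletion F) (η.2 v)) := by
    refine finprod_congr fun v => ?_
    rw [vecFinHeight_vecCons_one_adele, nnnorm_eq_normAbs]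
  have hprod : (∏ w : InfinitePlace F, vecArchNorm F w (![1, η] : Fin 2 → AdeleRing (𝓞 F) F) ^ w.mult) ≤
      NNReal.sqrt 2 ^ Fintype.card {w : InfinitePlace F // w.IsReal} * ∏ w : {w : InfinitePlace F // w.IsReal}, max 1 ‖η.1 w.1‖₊ := by
    calc (∏ w : InfinitePlace F, vecArchNorm F w (![1, η] : Fin 2 → AdeleRing (𝓞 F) F) ^ w.mult)
        ≤ ∏ w : InfinitePlace F, NNReal.sqrt 2 * max 1 ‖η.1 w‖₊ := Finset.prod_le_prod' fun w _ => harch w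
      _ = ∏ w : {w : InfinitePlace F // w.IsReal}, NNReal.sqrt 2 * max 1 ‖η.1 w.1‖₊ :=
          (Fintype.prod_equiv (Equiv.subtypeUnivEquiv fun w : InfinitePlace F => IsTotallyReal.isReal w) _ _
            fun w => rfl).symm
      _ = NNReal.sqrt 2 ^ Fintype.card {w : InfinitePlace F // w.IsReal} *
            ∏ w : {w : InfinitePlace F // w.IsReal}, max 1 ‖η.1 w.1‖₊ := by
          rw [Finset.prod_mul_distrib, Finset.prod_const, Finset.card_univ]
  rw [vecHeight, hfin]
  have h := mul_le_mul' hprod (le_refl (∏ᶠ v, max 1 (normAbs (v.adicCompletion F) (η.2 v))))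
  have h' := NNReal.coe_le_coe.2 h
  refine h'.trans (le_of_eq ?_)
  push_cast
  ring

variable {F} in
/-- from the split bound to the height bound: `(Π_w max)^{−r} · (Π_v max)^{−r} ≤ 2^{r₁ r/2} · h(1,η)^{−r}` for `r ≥ 0`.
[cite: Garrett2018, §2.2 (PDF p. 81)] -/
theorem prod_rpow_neg_mul_finprod_rpow_neg_le_vecHeight [IsTotallyReal F] (η : AdeleRing (𝓞 F) F) {r : ℝ} (hr : 0 ≤ r) :
    (∏ w : {w : InfinitePlace F // w.IsReal}, (max 1 ‖η.1 w.1‖) ^ (-r)) *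
        ((∏ᶠ v, max 1 (normAbs (v.adicCompletion F) (η.2 v)) : ℝ≥0) : ℝ) ^ (-r) ≤
      (Real.sqrt 2 ^ Fintype.card {w : InfinitePlace F // w.IsReal}) ^ r *
        (vecHeight F (![1, η] : Fin 2 → AdeleRing (𝓞 F) F) : ℝ) ^ (-r) := by
  set A : ℝ := ∏ w : {w : InfinitePlace F // w.IsReal}, max 1 ‖η.1 w.1‖ with hA
  set B : ℝ := ((∏ᶠ v, max 1 (normAbs (v.adicCompletion F) (η.2 v)) : ℝ≥0) : ℝ) with hB
  set K : ℝ := Real.sqrt 2 ^ Fintype.card {w : InfinitePlace F // w.IsReal} with hK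
  set h : ℝ := (vecHeight F (![1, η] : Fin 2 → AdeleRing (𝓞 F) F) : ℝ) with hh
  have hA1 : 1 ≤ A := by
    have h : ∏ _w : {w : InfinitePlace F // w.IsReal}, (1 : ℝ) ≤ A :=
      Finset.prod_le_prod (fun _ _ => zero_le_one) fun w _ => le_max_left _ _
    rwa [Finset.prod_const_one] at h
  have hA0 : 0 < A := lt_of_lt_of_le zero_lt_one hA1
  have hB1 : 1 ≤ B := by
    rw [hB, ← NNReal.coe_one, NNReal.coe_le_coe]
    exact one_le_finprod' fun v => le_max_left _ _
  have hB0 : 0 < B := lt_of_lt_of_le zero_lt_one hB1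
  have hK0 : 0 < K := pow_pos (Real.sqrt_pos.2 two_pos) _
  have hh_le : h ≤ K * (A * B) := vecHeight_vecCons_one_le F η
  have hh0 : 0 < h := by
    rw [hh, NNReal.coe_pos]
    exact lt_of_lt_of_le zero_lt_one (le_trans (one_le_classicalHeight_adele F η)
      (classicalHeight_le_vecHeight_vecCons_one_adele F η))
  -- `Π_w max^{-r} = A^{-r}`
  rw [Real.finsetProd_rpow _ _ (fun w _ => le_trans zero_le_one (le_max_left _ _)), ← hA, ← Real.mul_rpow hA0.le hB0.le]
  -- `(A B)^{-r} ≤ (h / K)^{-r} = K^r h^{-r}`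
  have hle : h / K ≤ A * B := by rw [div_le_iff₀ hK0, mul_comm]; exact hh_le
  calc (A * B) ^ (-r) ≤ (h / K) ^ (-r) := Real.rpow_le_rpow_of_nonpos (div_pos hh0 hK0) hle (neg_nonpos.2 hr)
    _ = K ^ r * h ^ (-r) := by
        rw [Real.div_rpow hh0.le hK0.le, Real.rpow_neg hK0.le, div_inv_eq_mul, mul_comm]

end Height

/-! ## §6 The majorant in height currency (sheet §2 (E1)) -/

section Main

variable (F : Type) [Field F] [NumberField F] [IsTotallyReal F] {m : ℕ}
  [MeasurableSpace (AdeleRing (𝓞 F) F)] [BorelSpace (AdeleRing (𝓞 F) F)]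

/-- **THE ADELIC GAUSS-TRANSFORM MAJORANT (Weil's condition (B) bound), height currency**: for a totally real `F`,
`S ∈ Sym_m(F)` with `det S ≠ 0`, `Φ ∈ 𝒮(𝔸_F^m)` and a Haar measure `ν` on `𝔸_F^m` there is `A ≥ 0` with, for EVERY ADELE `η`,
`‖∫ chirp F (η • ratMatrix S) Φ ∂ν‖ ≤ A · h(1, η)^{−m/2}`, `h = vecHeight`.
[cite: Weil1965, Chap. I n° 2 Prop. 2, p. 8; Chap. IV n° 40 Thm. 1, p. 57; n° 41, pp. 58–59] -/
theorem exists_norm_integral_chirp_smul_ratMatrix_le_vecHeight (ν : Measure (Fin m → AdeleRing (𝓞 F) F))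
    [ν.IsAddHaarMeasure] {S : Matrix (Fin m) (Fin m) F} (hS : S.IsSymm) (hdet : S.det ≠ 0)
    {Φ : (Fin m → AdeleRing (𝓞 F) F) → ℂ} (hΦ : Φ ∈ piSchwartzBruhat F (Fin m)) :
    ∃ A : ℝ, 0 ≤ A ∧ ∀ η : AdeleRing (𝓞 F) F,
      ‖∫ x, chirp F (η • ratMatrix F S) Φ x ∂ν‖ ≤
        A * (vecHeight F (![1, η] : Fin 2 → AdeleRing (𝓞 F) F) : ℝ) ^ (-((m : ℝ) / 2)) := by
  obtain ⟨C, hC0, hC⟩ := exists_norm_integral_chirp_smul_ratMatrix_le F ν hS hdet hΦ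
  set K : ℝ := (Real.sqrt 2 ^ Fintype.card {w : InfinitePlace F // w.IsReal}) ^ ((m : ℝ) / 2) with hK
  have hK0 : 0 ≤ K := Real.rpow_nonneg (pow_nonneg (Real.sqrt_nonneg _) _) _
  refine ⟨C * K, mul_nonneg hC0 hK0, fun η => ?_⟩
  refine (hC η).trans ?_
  rw [mul_assoc]
  exact mul_le_mul_of_nonneg_left (prod_rpow_neg_mul_finprod_rpow_neg_le_vecHeight η (by positivity)) hC0

end Main




/-! ## §7 (EDITION 2) FAMILY VERSIONS: uniformly bounded archimedean Schwartz seminorms ⇒ ONE constant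

For the (D-E)-type consumers (the Φ\*-2 tightness supply along archimedean cut-offs `Φ_∞ · β_n ⊗ Φ_f`, where the `Φ_∞ β_n` have
`n`-uniform Schwartz seminorms): the archimedean constant of §1 is controlled by finitely many Schwartz seminorms (★ ED. 2 of
`Weil1964/RealChirpIntegralDecay`, `exists_norm_integral_realChirpPi_blocks_le_of_uniform`), so every step of §§1–6 holds with ONE
constant for a whole family `{Φ_∞^{(c)} ⊗ Φ_f}_{c ∈ T}`. -/

section Family

variable (F : Type) [Field F] [NumberField F] [IsTotallyReal F] (m : ℕ)

/-- **ARCHIMEDEAN BOUND, FAMILY VERSION**: for a family `Φ_c ∈ 𝓢((F ⊗ ℝ)^m)`, `c ∈ T`, with uniformly bounded Schwartz seminorms,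
ONE constant serves all members and all `s ∈ F ⊗ ℝ` (★ `exists_norm_integral_realChirpPi_blocks_le_of_uniform`; the coordinate
transport `Φ ↦ Φ ∘ L⁻¹` is a continuous linear map of Schwartz spaces). [cite: Weil1965, Chap. I n° 2 Prop. 2, p. 8] [cite: HormanderALPDO1, §7.1] -/
theorem exists_norm_integral_archSdChar_diagonal_mul_le_of_uniform (μE : Measure (Fin m → mixedSpace F)) [μE.IsAddHaarMeasure]
    {d : Fin m → F} (hd : ∀ i, d i ≠ 0) {κ : Type*} {T : Set κ} {Φinf : κ → 𝓢((Fin m → mixedSpace F), ℂ)}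
    (hΦ : ∀ p : ℕ × ℕ, ∃ M : ℝ, ∀ c ∈ T, SchwartzMap.seminorm ℂ p.1 p.2 (Φinf c) ≤ M) :
    ∃ C : ℝ, 0 ≤ C ∧ ∀ c ∈ T, ∀ s : mixedSpace F,
      ‖∫ a, archSdChar F (Matrix.diagonal fun i => s * mixedEmbedding F (d i)) a * Φinf c a ∂μE‖ ≤
        C * ∏ w : {w : InfinitePlace F // w.IsReal}, (max 1 |s.1 w|) ^ (-((m : ℝ) / 2)) := by
  classical
  haveI : IsEmpty {w : InfinitePlace F // w.IsComplex} := isEmpty_isComplex F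
  -- real coordinates `a ↦ (a_{i,w})_{(i,w)}`
  set W := {w : InfinitePlace F // w.IsReal} with hW
  set e₀ : (Fin m → mixedSpace F) ≃ₗ[ℝ] EuclideanSpace ℝ (Fin m × W) :=
    { toFun := fun a => WithLp.toLp 2 fun j => (a j.1).1 j.2
      invFun := fun y i => (fun w => y (i, w), fun w => isEmptyElim w)
      map_add' := fun a b => by ext j; rfl
      map_smul' := fun r a => by ext j; rfl
      left_inv := fun a => by
        funext i
        exact Prod.ext (funext fun w => rfl) (funext fun w => isEmptyElim w)
      right_inv := fun y => by ext j; rfl } with he₀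
  set L : (Fin m → mixedSpace F) ≃L[ℝ] EuclideanSpace ℝ (Fin m × W) := e₀.toContinuousLinearEquiv with hL
  have hL_apply : ∀ (a : Fin m → mixedSpace F) (j : Fin m × W), L a j = (a j.1).1 j.2 := fun a j => rfl
  -- the transported Schwartz functions and the weights
  set Ψ : κ → 𝓢(EuclideanSpace ℝ (Fin m × W), ℂ) := fun c => SchwartzMap.compCLMOfContinuousLinearEquiv ℂ L.symm (Φinf c)
    with hΨ
  have hΨ_apply : ∀ c y, Ψ c y = Φinf c (L.symm y) := fun c y => rfl
  have hΨunif : ∀ p : ℕ × ℕ, ∃ M : ℝ, ∀ c ∈ T, SchwartzMap.seminorm ℂ p.1 p.2 (Ψ c) ≤ M := fun p =>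
    Literature.Analysis.Distribution.exists_forall_seminorm_le_of_uniform (𝕜 := ℂ)
      (SchwartzMap.compCLMOfContinuousLinearEquiv ℂ L.symm) hΦ p
  set α : Fin m × W → ℝ := fun j => -((mixedEmbedding F (d j.1)).1 j.2) with hα
  have hαne : ∀ j, α j ≠ 0 := fun j => by
    rw [hα, neg_ne_zero, mixedEmbedding_apply_isReal, ne_eq, map_eq_zero]
    exact hd j.1
  obtain ⟨C₀, hC₀0, hA⟩ := exists_norm_integral_realChirpPi_blocks_le_of_uniform (ι := Fin m × W) (W := W) Prod.snd hαne hΨunif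
  -- Haar transport
  haveI : (μE.map L).IsAddHaarMeasure := L.isAddHaarMeasure_map μE
  set c : ℝ≥0 := (μE.map L).addHaarScalarFactor (volume : Measure (EuclideanSpace ℝ (Fin m × W))) with hc
  have hμ : μE.map L = c • (volume : Measure (EuclideanSpace ℝ (Fin m × W))) := Measure.isAddLeftInvariant_eq_smul _ _
  -- fibres of `Prod.snd` have `m` elements
  have hfib : ∀ w : W, (Finset.univ.filter fun j : Fin m × W => j.2 = w).card = m := fun w => by
    rw [show (Finset.univ.filter fun j : Fin m × W => j.2 = w) = Finset.univ.map ⟨fun i : Fin m => (i, w),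
        fun i i' h => (Prod.mk.inj h).1⟩ by
      ext j
      simp only [Finset.mem_filter, Finset.mem_univ, true_and, Finset.mem_map, Function.Embedding.coeFn_mk]
      constructor
      · rintro rfl
        exact ⟨j.1, rfl⟩
      · rintro ⟨i, rfl⟩
        rfl]
    rw [Finset.card_map, Finset.card_univ, Fintype.card_fin]
  refine ⟨(c : ℝ) * C₀, mul_nonneg (NNReal.coe_nonneg c) hC₀0, fun k hk s => ?_⟩
  -- the phase in real coordinates
  set t : W → ℝ := fun w => s.1 w with ht
  have hphase : ∀ a : Fin m → mixedSpace F,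
      archSdChar F (Matrix.diagonal fun i => s * mixedEmbedding F (d i)) a =
        realChirpPi (fun j => t (Prod.snd j) * α j) (L a) := by
    intro a
    have hP : piTracePairing F (Fin m) a (a ᵥ* Matrix.diagonal fun i => s * mixedEmbedding F (d i)) =
        ∑ j : Fin m × W, s.1 j.2 * (mixedEmbedding F (d j.1)).1 j.2 * ((a j.1).1 j.2) ^ 2 := by
      rw [piTracePairing_apply, Fintype.sum_prod_type]
      refine Finset.sum_congr rfl fun i _ => ?_
      rw [Matrix.vecMul_diagonal, mixedTrace_apply,
        Finset.sum_eq_zero (s := (Finset.univ : Finset {w : InfinitePlace F // w.IsComplex})) (fun w _ => isEmptyElim w),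
        add_zero]
      refine Finset.sum_congr rfl fun w _ => ?_
      simp only [Prod.fst_mul, Pi.mul_apply]
      ring
    have hneg : -(piTracePairing F (Fin m) a (a ᵥ* Matrix.diagonal fun i => s * mixedEmbedding F (d i))) =
        ∑ j : Fin m × W, t j.2 * α j * (L a j) ^ 2 := by
      rw [hP, ← Finset.sum_neg_distrib]
      refine Finset.sum_congr rfl fun j _ => ?_
      rw [hL_apply]
      simp only [ht, hα]
      ring
    rw [archSdChar_apply, Real.fourierChar_apply, realChirpPi_eq_cexp_sum,
      show 2 * π * -(piTracePairing F (Fin m) a (a ᵥ* Matrix.diagonal fun i => s * mixedEmbedding F (d i))) =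
        2 * π * ∑ j : Fin m × W, t j.2 * α j * (L a j) ^ 2 by rw [hneg]]
    congr 1
    push_cast
    ring
  -- change of variables
  set G : EuclideanSpace ℝ (Fin m × W) → ℂ := fun y => realChirpPi (fun j => t (Prod.snd j) * α j) y * Ψ k y with hG
  have hint : ∫ a, archSdChar F (Matrix.diagonal fun i => s * mixedEmbedding F (d i)) a * Φinf k a ∂μE =
      (c : ℝ) • ∫ y : EuclideanSpace ℝ (Fin m × W), G y := by
    have h1 : (fun a => archSdChar F (Matrix.diagonal fun i => s * mixedEmbedding F (d i)) a * Φinf k a) =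
        fun a => G (L.toHomeomorph.toMeasurableEquiv a) := by
      funext a
      simp only [hG, Homeomorph.toMeasurableEquiv_coe, ContinuousLinearEquiv.coe_toHomeomorph, hphase, hΨ_apply,
        ContinuousLinearEquiv.symm_apply_apply]
    have hmap : μE.map (⇑L.toHomeomorph.toMeasurableEquiv) = μE.map L := by
      rw [Homeomorph.toMeasurableEquiv_coe]
      rfl
    rw [h1, ← integral_map_equiv, hmap, hμ, integral_smul_nnreal_measure, NNReal.smul_def]
  rw [hint, _root_.norm_smul, Real.norm_eq_abs, NNReal.abs_eq, mul_assoc]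
  refine mul_le_mul_of_nonneg_left ((hA k hk t).trans (le_of_eq ?_)) (NNReal.coe_nonneg c)
  congr 1
  refine Finset.prod_congr rfl fun w _ => ?_
  rw [hfib w]

variable {m}
variable [MeasurableSpace (AdeleRing (𝓞 F) F)] [BorelSpace (AdeleRing (𝓞 F) F)]

/-- **PURE TENSOR WITH AN ARCHIMEDEAN FAMILY, diagonal form**: fixed `Φ_f`, a family `Φ_∞^{(c)}` with uniformly bounded seminorms —
ONE `C` for all `c ∈ T` and all adeles `η`. [cite: Weil1965, Chap. I n° 2 Prop. 2, p. 8; Chap. IV n° 41, pp. 58–59] -/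
theorem exists_norm_integral_chirp_smul_diagonal_tensor_le_of_uniform (ν : Measure (Fin m → AdeleRing (𝓞 F) F))
    [ν.IsAddHaarMeasure] {d : Fin m → F} (hd : ∀ i, d i ≠ 0) {κ : Type*} {T : Set κ}
    {Φinf : κ → 𝓢((Fin m → mixedSpace F), ℂ)} (hΦ : ∀ p : ℕ × ℕ, ∃ M : ℝ, ∀ c ∈ T, SchwartzMap.seminorm ℂ p.1 p.2 (Φinf c) ≤ M)
    {Φfin : (Fin m → FiniteAdeleRing (𝓞 F) F) → ℂ} (hfin : Φfin ∈ SchwartzBruhat (Fin m → FiniteAdeleRing (𝓞 F) F)) :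
    ∃ C : ℝ, 0 ≤ C ∧ ∀ c ∈ T, ∀ η : AdeleRing (𝓞 F) F,
      ‖∫ x, chirp F (η • ratMatrix F (Matrix.diagonal d))
          (fun v => Φinf c (piArch F (Fin m) v) * Φfin (piFinite F (Fin m) v)) x ∂ν‖ ≤
        C * ((∏ w : {w : InfinitePlace F // w.IsReal}, (max 1 ‖η.1 w.1‖) ^ (-((m : ℝ) / 2))) *
          (((∏ᶠ v, max 1 (normAbs (v.adicCompletion F) (η.2 v)) : ℝ≥0) : ℝ) ^ (-((m : ℝ) / 2)))) := by
  -- measurable structures and Haar measures on the two factors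
  letI : MeasurableSpace (FiniteAdeleRing (𝓞 F) F) := borel _
  haveI : BorelSpace (FiniteAdeleRing (𝓞 F) F) := ⟨rfl⟩
  letI : ∀ v : HeightOneSpectrum (𝓞 F), MeasurableSpace (v.adicCompletion F) := fun v => borel _
  haveI : ∀ v : HeightOneSpectrum (𝓞 F), BorelSpace (v.adicCompletion F) := fun v => ⟨rfl⟩
  haveI : SecondCountableTopology (FiniteAdeleRing (𝓞 F) F) := secondCountableTopology_finiteAdeleRing F
  haveI : LocallyCompactSpace (FiniteAdeleRing (𝓞 F) F) := locallyCompactSpace_finiteAdeleRing' (K := F)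
  haveI : BorelSpace (Fin m → FiniteAdeleRing (𝓞 F) F) := Pi.borelSpace
  haveI : BorelSpace (Fin m → mixedSpace F) := Pi.borelSpace
  set μE : Measure (Fin m → mixedSpace F) := Measure.addHaar with hμE
  set μf : Measure (Fin m → FiniteAdeleRing (𝓞 F) F) := Measure.addHaar with hμf
  obtain ⟨c, hc, hν⟩ := exists_haar_eq_smul_map_prod F (Fin m) ν μE μf
  obtain ⟨Cinf, hCinf0, hA⟩ := exists_norm_integral_archSdChar_diagonal_mul_le_of_uniform F m μE hd hΦ
  obtain ⟨Cfin, hCfin0, hB⟩ := exists_norm_integral_mul_finiteAdeleAddChar_sum_sq_le F (Fin m) μf hd hfin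
  refine ⟨(c : ℝ) * Cinf * Cfin, mul_nonneg (mul_nonneg (NNReal.coe_nonneg c) hCinf0) hCfin0, fun k hk η => ?_⟩
  -- the integrand splits
  set S : Matrix (Fin m) (Fin m) (AdeleRing (𝓞 F) F) := η • ratMatrix F (Matrix.diagonal d) with hS
  set Ginf : (Fin m → mixedSpace F) → ℂ := fun a =>
    archSdChar F (Matrix.diagonal fun i => archHom F η * mixedEmbedding F (d i)) a * Φinf k a with hGinf
  set Gfin : (Fin m → FiniteAdeleRing (𝓞 F) F) → ℂ := fun b =>
    Φfin b * (finiteAdeleAddChar F (η.2 * ∑ i, algebraMap F (FiniteAdeleRing (𝓞 F) F) (d i) * b i ^ 2) : ℂ) with hGfin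
  have hsplit : ∀ p : (Fin m → mixedSpace F) × (Fin m → FiniteAdeleRing (𝓞 F) F),
      chirp F S (fun v => Φinf k (piArch F (Fin m) v) * Φfin (piFinite F (Fin m) v)) (piAdeleSplit F (Fin m) p) =
        Ginf p.1 * Gfin p.2 := by
    intro p
    rw [chirp_apply, sdChar_eq_mul, piArch_piAdeleSplit, piFinite_piAdeleSplit, hS, map_archHom_smul_ratMatrix_diagonal,
      map_snd_smul_ratMatrix_diagonal, finSdChar_diagonal_mul]
    simp only [hGinf, hGfin]
    ring
  have hint : ∫ x, chirp F S (fun v => Φinf k (piArch F (Fin m) v) * Φfin (piFinite F (Fin m) v)) x ∂ν =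
      (c : ℝ) • ((∫ a, Ginf a ∂μE) * ∫ b, Gfin b ∂μf) := by
    rw [integral_eq_smul_integral_prod hν]
    simp_rw [hsplit]
    rw [integral_prod_mul (μ := μE) (ν := μf) Ginf Gfin]
  rw [hint, _root_.norm_smul, Real.norm_eq_abs, NNReal.abs_eq, norm_mul]
  have h1 := hA k hk (archHom F η)
  simp_rw [abs_archHom_fst] at h1
  have h2 : ‖∫ b, Gfin b ∂μf‖ ≤ Cfin *
      (((∏ᶠ v, max 1 (normAbs (v.adicCompletion F) (η.2 v)) : ℝ≥0) : ℝ) ^ (-((m : ℝ) / 2))) := by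
    have h := hB η.2
    rwa [Fintype.card_fin] at h
  have hP0 : 0 ≤ ∏ w : {w : InfinitePlace F // w.IsReal}, (max 1 ‖η.1 w.1‖) ^ (-((m : ℝ) / 2)) :=
    Finset.prod_nonneg fun w _ => Real.rpow_nonneg (le_trans zero_le_one (le_max_left _ _)) _
  calc (c : ℝ) * (‖∫ a, Ginf a ∂μE‖ * ‖∫ b, Gfin b ∂μf‖)
      ≤ (c : ℝ) * ((Cinf * ∏ w : {w : InfinitePlace F // w.IsReal}, (max 1 ‖η.1 w.1‖) ^ (-((m : ℝ) / 2))) *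
          (Cfin * (((∏ᶠ v, max 1 (normAbs (v.adicCompletion F) (η.2 v)) : ℝ≥0) : ℝ) ^ (-((m : ℝ) / 2))))) := by
        refine mul_le_mul_of_nonneg_left (mul_le_mul h1 h2 (norm_nonneg _) (mul_nonneg hCinf0 hP0)) (NNReal.coe_nonneg c)
    _ = (c : ℝ) * Cinf * Cfin * ((∏ w : {w : InfinitePlace F // w.IsReal}, (max 1 ‖η.1 w.1‖) ^ (-((m : ℝ) / 2))) *
          (((∏ᶠ v, max 1 (normAbs (v.adicCompletion F) (η.2 v)) : ℝ≥0) : ℝ) ^ (-((m : ℝ) / 2)))) := by ring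

/-- **PURE TENSOR WITH AN ARCHIMEDEAN FAMILY, general symmetric `S`, height currency**: for `S ∈ Sym_m(F)`, `det S ≠ 0`, a fixed
`Φ_f ∈ 𝒮((𝔸_F^∞)^m)` and a family `Φ_∞^{(c)} ∈ 𝓢((F ⊗ ℝ)^m)`, `c ∈ T`, with uniformly bounded Schwartz seminorms, there is ONE `A ≥ 0`
with `‖∫ chirp F (η • ratMatrix S) (Φ_∞^{(c)} ⊗ Φ_f) ∂ν‖ ≤ A · h(1, η)^{−m/2}` for all `c ∈ T` and all adeles `η` (the rational frame
`Qᵀ` of §4 acts on the archimedean family by a FIXED continuous linear map, preserving the uniform bound).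
[cite: Weil1965, Chap. I n° 2 Prop. 2, p. 8; Chap. IV n° 40 Thm. 1, p. 57; n° 41, pp. 58–59] [cite: HormanderALPDO1, §7.1] -/
theorem exists_norm_integral_chirp_smul_ratMatrix_tensor_le_vecHeight_of_uniform (ν : Measure (Fin m → AdeleRing (𝓞 F) F))
    [ν.IsAddHaarMeasure] {S : Matrix (Fin m) (Fin m) F} (hS : S.IsSymm) (hdet : S.det ≠ 0) {κ : Type*} {T : Set κ}
    {Φinf : κ → 𝓢((Fin m → mixedSpace F), ℂ)} (hΦ : ∀ p : ℕ × ℕ, ∃ M : ℝ, ∀ c ∈ T, SchwartzMap.seminorm ℂ p.1 p.2 (Φinf c) ≤ M)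
    {Φfin : (Fin m → FiniteAdeleRing (𝓞 F) F) → ℂ} (hfin : Φfin ∈ SchwartzBruhat (Fin m → FiniteAdeleRing (𝓞 F) F)) :
    ∃ A : ℝ, 0 ≤ A ∧ ∀ c ∈ T, ∀ η : AdeleRing (𝓞 F) F,
      ‖∫ x, chirp F (η • ratMatrix F S) (fun v => Φinf c (piArch F (Fin m) v) * Φfin (piFinite F (Fin m) v)) x ∂ν‖ ≤
        A * (vecHeight F (![1, η] : Fin 2 → AdeleRing (𝓞 F) F) : ℝ) ^ (-((m : ℝ) / 2)) := by
  haveI : NeZero (2 : F) := ⟨two_ne_zero⟩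
  obtain ⟨P, Q, e, hPQ, hQP, hdiag, he⟩ := QuadraticForms.exists_congr_diagonal S hS
  have he' : ∀ i, e i ≠ 0 := he hdet
  have hSeq : S = Qᵀ * Matrix.diagonal e * Q := by
    rw [← hdiag]
    calc S = (P * Q)ᵀ * S * (P * Q) := by rw [hPQ, Matrix.transpose_one, Matrix.one_mul, Matrix.mul_one]
      _ = Qᵀ * (Pᵀ * S * P) * Q := by rw [Matrix.transpose_mul]; simp only [Matrix.mul_assoc]
  set γ : GL (Fin m) F := ⟨Qᵀ, Pᵀ, by rw [← Matrix.transpose_mul, hPQ, Matrix.transpose_one],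
    by rw [← Matrix.transpose_mul, hQP, Matrix.transpose_one]⟩ with hγ
  set g : GL (Fin m) (AdeleRing (𝓞 F) F) := ratGL F γ with hg
  have hgcoe : (g : Matrix (Fin m) (Fin m) (AdeleRing (𝓞 F) F)) = ratMatrix F Qᵀ := rfl
  -- the twisted tensors `(Φ_∞^{(c)} ∘ g⁻¹_∞) ⊗ (Φ_f ∘ g⁻¹_f)`
  set Linf : 𝓢((Fin m → mixedSpace F), ℂ) →L[ℂ] 𝓢((Fin m → mixedSpace F), ℂ) :=
    SchwartzMap.compCLMOfContinuousLinearEquiv ℂ (vecArchCLE m F (GLn.archUnit m F g⁻¹)) with hLinf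
  set Φinf' : κ → 𝓢((Fin m → mixedSpace F), ℂ) := fun c => Linf (Φinf c) with hΦinf'
  set Φfin' : (Fin m → FiniteAdeleRing (𝓞 F) F) → ℂ := fun y => Φfin (vecFinHomeomorph (GLn.finUnit m F g⁻¹) y) with hΦfin'
  have hfin' : Φfin' ∈ SchwartzBruhat (Fin m → FiniteAdeleRing (𝓞 F) F) := by
    obtain ⟨hlc, hcs⟩ := (mem_schwartzBruhat_iff).1 hfin
    exact (mem_schwartzBruhat_iff).2 ⟨hlc.comp_continuous (vecFinHomeomorph _).continuous, hcs.comp_homeomorph _⟩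
  have hΦ' : ∀ p : ℕ × ℕ, ∃ M : ℝ, ∀ c ∈ T, SchwartzMap.seminorm ℂ p.1 p.2 (Φinf' c) ≤ M := fun p =>
    Literature.Analysis.Distribution.exists_forall_seminorm_le_of_uniform (𝕜 := ℂ) Linf hΦ p
  have htwist : ∀ c, twist F g⁻¹ (fun v => Φinf c (piArch F (Fin m) v) * Φfin (piFinite F (Fin m) v)) =
      fun v => Φinf' c (piArch F (Fin m) v) * Φfin' (piFinite F (Fin m) v) := by
    intro c
    funext x
    simp only [twist_apply, hΦinf', hΦfin', hLinf, SchwartzMap.compCLMOfContinuousLinearEquiv_apply, Function.comp_apply,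
      vecArchCLE_apply, GLn.coe_archUnit, piArch_vecMul, piFinite_vecMul]
    rfl
  obtain ⟨C, hC0, hC⟩ := exists_norm_integral_chirp_smul_diagonal_tensor_le_of_uniform F ν he' hΦ' hfin'
  set K : ℝ := (Real.sqrt 2 ^ Fintype.card {w : InfinitePlace F // w.IsReal}) ^ ((m : ℝ) / 2) with hK
  have hK0 : 0 ≤ K := Real.rpow_nonneg (pow_nonneg (Real.sqrt_nonneg _) _) _
  refine ⟨((adelicAbsDet m F g⁻¹ : ℝ≥0) : ℝ) * C * K, mul_nonneg (mul_nonneg (NNReal.coe_nonneg _) hC0) hK0, fun c hc η => ?_⟩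
  have hconj : η • ratMatrix F S = (g : Matrix (Fin m) (Fin m) (AdeleRing (𝓞 F) F)) *
      (η • ratMatrix F (Matrix.diagonal e)) * (g : Matrix (Fin m) (Fin m) (AdeleRing (𝓞 F) F))ᵀ := by
    rw [hgcoe, hSeq, ratMatrix_transpose_mul_diagonal_mul]
  have htw : (fun v => Φinf c (piArch F (Fin m) v) * Φfin (piFinite F (Fin m) v)) =
      twist F g (twist F g⁻¹ (fun v => Φinf c (piArch F (Fin m) v) * Φfin (piFinite F (Fin m) v))) := by
    rw [← twist_mul, mul_inv_cancel, twist_one]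
  rw [hconj, htw, integral_chirp_conj_twist, htwist, _root_.norm_smul, Real.norm_eq_abs, NNReal.abs_eq, mul_assoc, mul_assoc]
  refine mul_le_mul_of_nonneg_left ?_ (NNReal.coe_nonneg _)
  refine (hC c hc η).trans ?_
  exact mul_le_mul_of_nonneg_left (prod_rpow_neg_mul_finprod_rpow_neg_le_vecHeight η (by positivity)) hC0

end Family


end Literature.NumberTheory.Weil1965

end
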